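import Summits.Parity.GeneralizedHardyLittlewood.Theorems.LeeYangFibresCellParityLawKernelDefs
import Summits.Parity.GeneralizedHardyLittlewood.Theorems.LeeYangFibresCellParityLawMertensAux
import Summits.Parity.GeneralizedHardyLittlewood.Theorems.LeeYangFibresCellParityLawMertens
import Literature.NumberTheory.Sieve.JurkatRichertRefutation
import HarnessLib

/-!
# Route `LeeYangFibres`, crux `CellParityLaw` (stmt-Parity-14109), line `section-annihilator`:
# the registered stub `stub_sectionMertensTwo` — two-sided sharp Mertens at the cell threshold

We prove `SectionMertensLowerHead → SectionMertensTwo` (vocabulary file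
`LeeYangFibresCellParityLawKernelDefs`, skeleton v13): for a non-degenerate system
`Ψ = (ψ₀, …, ψ_t)` of one-dimensional forms of size `‖Ψ‖_N ≤ L`, a coordinate `i` whose section
density `g = sectionDensity Ψ i` has no degenerate prime and whose sub-system `Ψ₋ᵢ` has `𝔖(Ψ₋ᵢ) ≠ 0`,
and `N ≥ N₀(t, L, u)` (`u ≥ 2`), at the cell threshold `z = N^{1/u}` (`zOf N u`)

  `|e^γ V(z) - u H/log N| ≤ C H/log² N`,  `V(z) = ∏_{p<z} (1 - g(p))`, `H = H_{Ψ,i}` (`sectionH`),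

with `C = u (C₁ + 32 t + 50 u)`, `C₁ = C₁(t, L)` the constant of the lower head bound.

Proof. With `E_p = (1 - g(p))/(1 - 1/p)` and `Π(z) = ∏_{p<z} (1 - 1/p)⁻¹` (`PairProducts.mertensProd`):
`V(z) = (∏_{p<m} E_p) · Π(z)⁻¹`, `m = ⌈z⌉` (`MertensAux.prod_one_sub_eq`). Mertens' product theorem
with rate (`PairProducts.abs_log_mertensProd_sub_le`): `Π(z) = e^{a} (log z) e^γ` with
`|a| ≤ 25/log z = 25u/log N`, so `e^γ V(z) = (u/log N) · P e^{-a}`, `P = ∏_{p<m} E_p`, and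
`|e^{-a} - 1| ≤ 50u/log N` (`Real.abs_exp_sub_one_le`). The head of Bombieri's constant is pinched:
`H (1 - C₁ log N/m) ≤ P ≤ H (1 + 16t/m)` (the hypothesis `SectionMertensLowerHead` and the landed
`MertensAux.head_le`), and `m ≥ z ≥ log² N` for large `N` (`isLittleO_log_rpow_rpow_atTop`), whence
`|P e^{-a} - H| ≤ H (32t + C₁ + 50u)/log N` (`MertensTwoAux.abs_mul_sub_le`).

References: E. Bombieri, *The asymptotic sieve*, Rend. Accad. Naz. XL (5) 1/2 (1975/76) 243–269
[BombieriAsymptoticSieve1976]; G. H. Hardy, E. M. Wright, Thm 429 (Mertens) [HardyWright2008].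
-/

noncomputable section

open scoped BigOperators Topology Classical
open Finset Filter Asymptotics Literature.NumberTheory.Sieve

namespace Summit.Parity.GeneralizedHardyLittlewood.Cruxes.CellParityLaw.SectionAnnihilator

namespace MertensTwoAux

/-- The pinching inequality: if `H (1 - b) ≤ P ≤ H (1 + a)` with `P, H, a, b ≥ 0` and
`|F - 1| ≤ e ≤ 1`, then `|P F - H| ≤ H (2a + b + e)`. -/
theorem abs_mul_sub_le {P F H a b e : ℝ} (hH : 0 ≤ H) (hP : 0 ≤ P) (ha : 0 ≤ a) (hb : 0 ≤ b)
    (he0 : 0 ≤ e) (he1 : e ≤ 1) (hup : P ≤ H * (1 + a)) (hlow : H * (1 - b) ≤ P)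
    (hF : |F - 1| ≤ e) : |P * F - H| ≤ H * (2 * a + b + e) := by
  obtain ⟨hF1, hF2⟩ := abs_le.mp hF
  rw [abs_le]
  constructor
  · have h1 : H * (1 - b) * (1 - e) ≤ P * (1 - e) := mul_le_mul_of_nonneg_right hlow (by linarith)
    have h2 : P * (1 - e) ≤ P * F := mul_le_mul_of_nonneg_left (by linarith) hP
    nlinarith [mul_nonneg hH (mul_nonneg hb he0), mul_nonneg hH ha]
  · have h1 : P * F ≤ P * (1 + e) := mul_le_mul_of_nonneg_left (by linarith) hP
    have h2 : P * (1 + e) ≤ H * (1 + a) * (1 + e) := mul_le_mul_of_nonneg_right hup (by linarith)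
    nlinarith [mul_le_mul_of_nonneg_left he1 (mul_nonneg hH ha), mul_nonneg hH hb]

/-- Eventually (along the naturals) `log² N ≤ N^{1/u}` for `u > 0`
(`(log x)² = o(x^{1/u})`, Mathlib's `isLittleO_log_rpow_rpow_atTop`). -/
theorem eventually_log_sq_le_rpow {u : ℝ} (hu : 0 < u) :
    ∀ᶠ N : ℕ in atTop, Real.log (N : ℝ) ^ 2 ≤ (N : ℝ) ^ (1 / u) := by
  have hlo := (isLittleO_log_rpow_rpow_atTop (2 : ℝ) (by positivity : (0 : ℝ) < 1 / u)).bound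
    one_pos
  have hev : ∀ᶠ x : ℝ in atTop, Real.log x ^ 2 ≤ x ^ (1 / u) := by
    filter_upwards [hlo, eventually_ge_atTop 1] with x hx hx1
    have hl : 0 ≤ Real.log x := Real.log_nonneg hx1
    rw [one_mul, Real.norm_eq_abs, Real.norm_eq_abs, Real.rpow_two, abs_of_nonneg (pow_nonneg hl 2),
      abs_of_nonneg (Real.rpow_nonneg (by linarith) _)] at hx
    exact hx
  exact tendsto_natCast_atTop_atTop.eventually hev

/-- Mertens' product theorem with rate in multiplicative form: for `z ≥ 2`,
`Π(z) = e^{a} · log z · e^γ` with `|a| ≤ 25/log z` (`PairProducts.abs_log_mertensProd_sub_le`). -/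
theorem mertensProd_eq_exp_mul {z : ℝ} (hz : 2 ≤ z) :
    ∃ a : ℝ, |a| ≤ 25 / Real.log z ∧
      PairProducts.mertensProd z =
        Real.exp a * Real.log z * Real.exp Real.eulerMascheroniConstant := by
  have hlogz : 0 < Real.log z := Real.log_pos (by linarith)
  refine ⟨Real.log (PairProducts.mertensProd z) - Real.log (Real.log z) -
    Real.eulerMascheroniConstant, PairProducts.abs_log_mertensProd_sub_le hz, ?_⟩
  have h1 : Real.log (PairProducts.mertensProd z) =
      (Real.log (PairProducts.mertensProd z) - Real.log (Real.log z) -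
        Real.eulerMascheroniConstant) + Real.log (Real.log z) + Real.eulerMascheroniConstant := by
    ring
  conv_lhs => rw [← Real.exp_log (PairProducts.mertensProd_pos z), h1]
  rw [Real.exp_add, Real.exp_add, Real.exp_log hlogz]

end MertensTwoAux

open MertensTwoAux in
/-- **`stub_sectionMertensTwo`** (registered stub of the line `section-annihilator`, skeleton v13): the
two-sided sharp Mertens evaluation at the cell threshold, `SectionMertensLowerHead → SectionMertensTwo`,
with `C = u (C₁ + 32t + 50u)` (`C₁` the lower-head constant) and `N₀` collected from: the lower-head
threshold, `log N ≥ L + 18t + 50u + 3`, and `log² N ≤ N^{1/u}`. -/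
theorem stub_sectionMertensTwo : SectionMertensLowerHead → SectionMertensTwo := by
  intro hLH t L u hu
  obtain ⟨C₁, hC₁, N₁, hN₁⟩ := hLH t L
  have hu0 : (0 : ℝ) < u := by exact_mod_cast (by omega : 0 < u)
  have ht0 : (0 : ℝ) ≤ t := Nat.cast_nonneg t
  have hL0 : (0 : ℝ) ≤ L := Nat.cast_nonneg L
  -- the threshold `N₀`
  set A : ℝ := (L : ℝ) + 18 * t + 50 * u + 3 with hA
  have h1 : ∀ᶠ N : ℕ in atTop, N₁ ≤ N := eventually_ge_atTop N₁
  have h2 : ∀ᶠ N : ℕ in atTop, A ≤ Real.log (N : ℝ) :=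
    (Real.tendsto_log_atTop.comp tendsto_natCast_atTop_atTop).eventually_ge_atTop A
  have h3 : ∀ᶠ N : ℕ in atTop, Real.log (N : ℝ) ^ 2 ≤ (N : ℝ) ^ (1 / (u : ℝ)) :=
    eventually_log_sq_le_rpow hu0
  have h4 : ∀ᶠ N : ℕ in atTop, 1 ≤ N := eventually_ge_atTop 1
  obtain ⟨N₀, hN₀⟩ := Filter.eventually_atTop.1 (h1.and (h2.and (h3.and h4)))
  refine ⟨u * (C₁ + 32 * t + 50 * u), N₀, fun N hN Ψ hΨ hL i hg1 hne => ?_⟩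
  obtain ⟨hNN₁, hAN, hsq, hN1⟩ := hN₀ N hN
  have hNr : (0 : ℝ) < N := by exact_mod_cast hN1
  have hA3 : 3 ≤ A := by rw [hA]; linarith
  have hℓ50 : 50 * (u : ℝ) ≤ Real.log N := by rw [hA] at hAN; linarith
  have hℓ1 : 1 ≤ Real.log N := by linarith
  have hℓpos : 0 < Real.log N := by linarith
  have hH0 : 0 ≤ sectionH Ψ i := MertensAux.sectionH_nonneg Ψ hΨ i hne
  -- the threshold `z = N^{1/u}` and `m = ⌈z⌉ ≥ z ≥ log² N ≥ log N ≥ A`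
  set z : ℝ := zOf N u with hzdef
  have hzℓ : Real.log N ^ 2 ≤ z := by rw [hzdef]; exact hsq
  have hℓsq : Real.log N ≤ Real.log N ^ 2 := by
    nlinarith [mul_le_mul_of_nonneg_left hℓ1 hℓpos.le]
  have hzA : A ≤ z := hAN.trans (hℓsq.trans hzℓ)
  have hz2 : 2 ≤ z := by linarith
  have hlogz : Real.log z = Real.log N / u := by
    rw [hzdef, zOf, Real.log_rpow hNr]; ring
  have hlogzpos : 0 < Real.log z := by rw [hlogz]; positivity
  have hzm : z ≤ (⌈z⌉₊ : ℕ) := Nat.le_ceil z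
  have hmℓ2 : Real.log N ^ 2 ≤ (⌈z⌉₊ : ℕ) := hzℓ.trans hzm
  have hmℓ : Real.log N ≤ (⌈z⌉₊ : ℕ) := hℓsq.trans hmℓ2
  have hmA : A ≤ ((⌈z⌉₊ : ℕ) : ℝ) := hzA.trans hzm
  have hm0 : (0 : ℝ) < (⌈z⌉₊ : ℕ) := by linarith
  have hmL : L < ⌈z⌉₊ := by
    rw [hA] at hmA; exact_mod_cast (show (L : ℝ) < (⌈z⌉₊ : ℕ) by linarith)
  have hmt : 2 * t + 2 ≤ ⌈z⌉₊ := by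
    rw [hA] at hmA; exact_mod_cast (show (2 * t + 2 : ℝ) ≤ (⌈z⌉₊ : ℕ) by linarith)
  have hm16 : 16 * t ≤ ⌈z⌉₊ := by
    rw [hA] at hmA; exact_mod_cast (show (16 * t : ℝ) ≤ (⌈z⌉₊ : ℕ) by linarith)
  -- the head of Bombieri's constant, pinched
  have hhead := MertensAux.head_le Ψ hΨ hL i hg1 hne hmL hmt hm16
  have hlow := hN₁ N hNN₁ Ψ hΨ hL i hg1 hne ⌈z⌉₊ hmL hmt
  -- Mertens with rate: `Π(z) = e^a (log z) e^γ`, `|a| ≤ 25 u/log N`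
  obtain ⟨a, ha, hPi⟩ := mertensProd_eq_exp_mul hz2
  rw [hlogz, div_div_eq_mul_div] at ha
  have ha1 : |-a| ≤ 1 := by
    rw [abs_neg]
    refine ha.trans ?_
    rw [div_le_one hℓpos]
    linarith
  have hF : |Real.exp (-a) - 1| ≤ 50 * u / Real.log N := by
    calc |Real.exp (-a) - 1| ≤ 2 * |-a| := Real.abs_exp_sub_one_le ha1
      _ = 2 * |a| := by rw [abs_neg]
      _ ≤ 2 * (25 * u / Real.log N) := by gcongr
      _ = 50 * u / Real.log N := by ring
  have he1 : 50 * (u : ℝ) / Real.log N ≤ 1 := by rw [div_le_one hℓpos]; linarith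
  -- `e^γ V(z) = (u/log N) · P e^{-a}`
  rw [MertensAux.prod_one_sub_eq Ψ i z, hPi]
  set P : ℝ := ∏ p ∈ Nat.primesBelow ⌈z⌉₊, (1 - sectionDensity Ψ i p) / (1 - (p : ℝ)⁻¹)
  have hP0 : 0 ≤ P := Finset.prod_nonneg fun p hp =>
    MertensAux.eulerFactor_nonneg Ψ i (Nat.prime_of_mem_primesBelow hp)
      (hg1 _ (Nat.prime_of_mem_primesBelow hp))
  have hE : Real.exp Real.eulerMascheroniConstant *
        (P * (Real.exp a * Real.log z * Real.exp Real.eulerMascheroniConstant)⁻¹) -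
      u * sectionH Ψ i / Real.log N =
      (u / Real.log N) * (P * Real.exp (-a) - sectionH Ψ i) := by
    have hℓne : Real.log (N : ℝ) ≠ 0 := hℓpos.ne'
    have hune : (u : ℝ) ≠ 0 := hu0.ne'
    rw [hlogz, Real.exp_neg]
    field_simp
  rw [hE, abs_mul, abs_of_pos (div_pos hu0 hℓpos)]
  -- the pinching
  have hkey := abs_mul_sub_le hH0 hP0 (div_nonneg (by positivity) (Nat.cast_nonneg _))
    (div_nonneg (mul_nonneg hC₁ hℓpos.le) (Nat.cast_nonneg _)) (div_nonneg (by positivity) hℓpos.le)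
    he1 hhead hlow hF
  have ha' : 16 * (t : ℝ) / (⌈z⌉₊ : ℕ) ≤ 16 * t / Real.log N :=
    div_le_div_of_nonneg_left (by positivity) hℓpos hmℓ
  have hb' : C₁ * Real.log N / (⌈z⌉₊ : ℕ) ≤ C₁ / Real.log N := by
    rw [div_le_div_iff₀ hm0 hℓpos]
    nlinarith [mul_le_mul_of_nonneg_left hmℓ2 hC₁]
  have hsum : 2 * (16 * (t : ℝ) / (⌈z⌉₊ : ℕ)) + C₁ * Real.log N / (⌈z⌉₊ : ℕ) + 50 * u / Real.log N ≤
      (C₁ + 32 * t + 50 * u) / Real.log N := by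
    rw [show (C₁ + 32 * (t : ℝ) + 50 * u) / Real.log N =
      2 * (16 * (t : ℝ) / Real.log N) + C₁ / Real.log N + 50 * u / Real.log N by ring]
    linarith
  calc (u : ℝ) / Real.log N * |P * Real.exp (-a) - sectionH Ψ i|
      ≤ (u : ℝ) / Real.log N * (sectionH Ψ i * ((C₁ + 32 * t + 50 * u) / Real.log N)) :=
        mul_le_mul_of_nonneg_left (hkey.trans (mul_le_mul_of_nonneg_left hsum hH0))
          (div_pos hu0 hℓpos).le
    _ = u * (C₁ + 32 * t + 50 * u) * sectionH Ψ i / Real.log N ^ 2 := by ring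

end Summit.Parity.GeneralizedHardyLittlewood.Cruxes.CellParityLaw.SectionAnnihilator

end
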